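import Summits.CriticalPhenomena.PercolationContinuityZ3.Theorems.PercNearOneGluingNoHeavyQuantIndepBlobOneLight
import HarnessLib

/-!
# QUANT lane R8, DIB\* with ONE LIGHT BLOB in the CORNER (heavy mass `≤ 2j`), EVERY floor: merge, or Markov on the heavy failures

builds on p205010 (kernel theorem, internal audit signed; external expert review pending)

Support file (`--supports stmt-CriticalPhenomena-4575`), QUANT lane census seat prim-quant-census-1 (gen 14), rung R8 of
`run/shared/lean/prim/quant/LADDER.md`; memo `run/shared/lean/prim/quant/prim-quant-census-1/TREES-G14.md` §4.5.

After lead g15's `IndepBlob.dibStar_of_le_half` (DIB\* at every floor `≤ 1/2`, p251439) and `sizeRow_with_extra_blobs` (floor `≥ 1/2`, heavy total `≥ 2j+1`, p252105),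
the open part of census-2 g49's conjecture DIB\* is the CORNER `{x > 1/2, heavy total ≤ 2j, light blobs present}` (README V192).  This file closes the corner for ONE
light blob, at every floor `1/2 ≤ x < 1` (below `1/2` the lead's row applies) and with NO hypothesis on the heavy sizes:

* `IndepBlob.heavy_fail_markov` — Markov on the closed heavy mass: `(C − t)·P(X ≤ t) ≤ C − B` (`C = Σ c`, `B = Σ c·p`, any level `t`).
* `IndepBlob.tail_ge_of_oneLight_corner` — **floor `1/2 ≤ x < 1`, heavy gates `p i ∈ [x, 1]`, sizes `c i ∈ ℕ` with `Σ c ≤ 2j`, light blob `b ≤ j`, `x² ≤ g ≤ x`, credit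
  `2j < Σ c·p + b(g − x²)/(1 − x)` ⟹ `x ≤ P(N ≥ j+1)`.**  PROOF.  (G) if `g·Σ c ≥ j` merge the light blob into a heavy one (`Merge.exists_tailMerge_le` + `far_indepBlob`,
  as in `tail_ge_of_oneLight`).  (F) otherwise `P(N ≤ j) = g·P(X ≤ j − b) + (1 − g)·P(X ≤ j) ≤ φ/(C − j)` with `φ = C − B` (Markov on the heavy failures), and
  `φ ≤ (1 − x)(C − j)`: with `κ = (g − x²)/(1 − x)` the credit gives `B > 2j − jκ`; if `κ ≤ 1 − x` then `B > j(1 + x)` and `C − j ≤ j` finish; if `κ > 1 − x` then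
  `g > x² + (1 − x)² ≥ 1 − x` (as `x ≥ 1/2`) and `¬G` gives `xC < xj/g ≤ j(1 + x − κ)`, because `(1 − x)(g(1 + x − κ) − x) = (x − g)(g + x − 1) ≥ 0`.
Together with `tail_ge_of_oneLight` (floors `x³ + x ≥ 1`, any heavy total) and the lead's two rows, DIB\* WITH ONE LIGHT BLOB HOLDS AT EVERY FLOOR (assembly into the typed
`Quant.IndepBlob.DIBStar` left to the typer).  [cite: KozmaNitzan2024, Conjecture 3 (p. 15)] (the gluing rows served); the row is [this work].
Theorems only, no sorries, standard axioms.
-/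

namespace Summit.CriticalPhenomena.PercolationContinuityZ3.Theorems

namespace Quant

namespace IndepBlob

open Finset

variable {ι : Type*} [Fintype ι] [DecidableEq ι]

/-- **Markov on the closed heavy mass.**  Gates `0 ≤ p i ≤ 1`, sizes `c i ∈ ℕ`, `C = Σ c`, `B = Σ c·p`, any real level `t`:
`(C − t) · P(Σ_{i∈W} c i ≤ t) ≤ C − B` (pointwise `(C − t)·𝟙[X ≤ t] ≤ C − X`). [folklore] -/
theorem heavy_fail_markov (p : ι → ℝ) (hp0 : ∀ i, 0 ≤ p i) (hp1 : ∀ i, p i ≤ 1) (c : ι → ℕ) (t : ℝ) :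
    ((∑ i, (c i : ℝ)) - t) * ∑ W ∈ (Finset.univ : Finset (Finset ι)).filter (fun W => ((∑ k ∈ W, c k : ℕ) : ℝ) ≤ t),
        (∏ k, if k ∈ W then p k else 1 - p k) ≤
      (∑ i, (c i : ℝ)) - ∑ i, (c i : ℝ) * p i := by
  set C : ℝ := ∑ i, (c i : ℝ) with hC
  have hw0 : ∀ W : Finset ι, 0 ≤ (∏ k, if k ∈ W then p k else 1 - p k) := bernoulliWeight_nonneg hp0 hp1
  have hcW : ∀ W : Finset ι, ((∑ k ∈ W, c k : ℕ) : ℝ) ≤ C := by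
    intro W; rw [hC]; push_cast
    exact Finset.sum_le_sum_of_subset_of_nonneg (Finset.subset_univ W) fun _ _ _ => Nat.cast_nonneg _
  -- pointwise bound, summed
  have hpt : ∀ W : Finset ι, (C - t) * (if ((∑ k ∈ W, c k : ℕ) : ℝ) ≤ t then (∏ k, if k ∈ W then p k else 1 - p k) else 0) ≤
      (∏ k, if k ∈ W then p k else 1 - p k) * (C - ((∑ k ∈ W, c k : ℕ) : ℝ)) := by
    intro W
    split_ifs with h
    · rw [mul_comm]; exact mul_le_mul_of_nonneg_left (by linarith) (hw0 W)
    · rw [mul_zero]; exact mul_nonneg (hw0 W) (by linarith [hcW W])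
  have hsum := Finset.sum_le_sum fun W (_ : W ∈ (Finset.univ : Finset (Finset ι))) => hpt W
  rw [← Finset.mul_sum, ← Finset.sum_filter] at hsum
  refine hsum.trans (le_of_eq ?_)
  have e : ∀ W : Finset ι, (∏ k, if k ∈ W then p k else 1 - p k) * (C - ((∑ k ∈ W, c k : ℕ) : ℝ)) =
      C * (∏ k, if k ∈ W then p k else 1 - p k) - (∏ k, if k ∈ W then p k else 1 - p k) * (∑ k ∈ W, (c k : ℝ)) := by
    intro W; push_cast; ring
  rw [Finset.sum_congr rfl fun W _ => e W, Finset.sum_sub_distrib, ← Finset.mul_sum, sum_bernoulliWeight, mul_one,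
    sum_bernoulliWeight_mul_count p (fun i => (c i : ℝ))]

/-- **DIB\* with one light blob in the corner `Σ c ≤ 2j`, every floor.**  See the module docstring. [this work] -/
theorem tail_ge_of_oneLight_corner (p : ι → ℝ) (c : ι → ℕ) (x g : ℝ) (b j : ℕ)
    (hx0 : 0 < x) (hxhalf : 1 / 2 ≤ x) (hx1 : x < 1)
    (hp : ∀ i, x ≤ p i) (hp1 : ∀ i, p i ≤ 1) (hgl : x ^ 2 ≤ g) (hgu : g ≤ x) (hbj : b ≤ j)
    (hcorner : (∑ i, (c i : ℝ)) ≤ 2 * j)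
    (hcredit : (2 * j : ℝ) < (∑ i, (c i : ℝ) * p i) + b * ((g - x ^ 2) / (1 - x))) :
    x ≤ ∑ W : Finset ι, (∏ k, if k ∈ W then p k else 1 - p k) *
        (g * (if j + 1 ≤ ∑ k ∈ W, c k + b then (1 : ℝ) else 0) +
          (1 - g) * (if j + 1 ≤ ∑ k ∈ W, c k then (1 : ℝ) else 0)) := by
  have hp0 : ∀ i, 0 ≤ p i := fun i => hx0.le.trans (hp i)
  have hg0 : 0 ≤ g := le_trans (sq_nonneg x) hgl
  have hg1 : g ≤ 1 := hgu.trans hx1.le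
  have hw0 : ∀ W : Finset ι, 0 ≤ (∏ k, if k ∈ W then p k else 1 - p k) := bernoulliWeight_nonneg hp0 hp1
  set C : ℝ := ∑ i, (c i : ℝ) with hC
  set B : ℝ := ∑ i, (c i : ℝ) * p i with hB
  set κ : ℝ := (g - x ^ 2) / (1 - x) with hκ
  have h1x : 0 < 1 - x := by linarith
  have hκ0 : 0 ≤ κ := div_nonneg (by linarith) h1x.le
  have hκx : κ ≤ x := by rw [hκ, div_le_iff₀ h1x]; nlinarith
  have hb0 : (0 : ℝ) ≤ b := Nat.cast_nonneg _
  have hbj' : (b : ℝ) ≤ j := by exact_mod_cast hbj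
  have hj0 : (0 : ℝ) ≤ j := Nat.cast_nonneg _
  have hBC : B ≤ C := Finset.sum_le_sum fun i _ => by
    have := hp1 i; have : (0 : ℝ) ≤ c i := Nat.cast_nonneg _
    nlinarith
  have hBx : x * C ≤ B := by
    rw [hC, hB, Finset.mul_sum]
    exact Finset.sum_le_sum fun i _ => by rw [mul_comm]; exact mul_le_mul_of_nonneg_left (hp i) (Nat.cast_nonneg _)
  -- the credit gives `B > 2j − jκ ≥ j(2 − x) > j`
  have hBlow : (2 * j : ℝ) - j * κ < B := by
    have : (b : ℝ) * κ ≤ j * κ := mul_le_mul_of_nonneg_right hbj' hκ0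
    linarith
  have hjC : (j : ℝ) < C := by nlinarith
  by_cases hG : (j : ℝ) ≤ g * C
  · -- (G) merge the light blob into some heavy blob, then `far_indepBlob` (as in `tail_ge_of_oneLight`)
    have hpos : ∃ k, 0 < c k := by
      by_contra hnone
      push Not at hnone
      have hC0' : C = 0 := by
        rw [hC]; exact Finset.sum_eq_zero fun i _ => by simp [Nat.le_zero.mp (hnone i)]
      rw [hC0'] at hjC; linarith
    obtain ⟨ℓ, -, hℓ⟩ := Quant.Merge.exists_tailMerge_le (fun W : Finset ι => ∏ k, if k ∈ W then p k else 1 - p k) hw0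
      (fun W => W) (fun _ => 0) c b j g (by simpa [hC] using hG) hpos
    simp only [add_zero] at hℓ
    refine le_trans ?_ hℓ
    set c' : ι → ℕ := fun k => if k = ℓ then c k + b else c k with hc'
    have hc'k : ∀ k, c' k = c k + (if k = ℓ then b else 0) := by
      intro k; simp only [hc']; split_ifs <;> simp
    have hsum' : ∀ W : Finset ι, ∑ k ∈ W, c k + (if ℓ ∈ W then b else 0) = ∑ k ∈ W, c' k := by
      intro W
      rw [Finset.sum_congr rfl (fun k _ => hc'k k), Finset.sum_add_distrib, Finset.sum_ite_eq' W ℓ (fun _ => b)]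
    have hbudget : (2 * j : ℝ) < 0 * x + ∑ i, (c' i : ℝ) * p i := by
      have e : ∑ i, (c' i : ℝ) * p i = B + b * p ℓ := by
        have h' : ∀ i, (c' i : ℝ) * p i = (c i : ℝ) * p i + (if i = ℓ then (b : ℝ) * p i else 0) := by
          intro i; rw [hc'k i]; push_cast; split_ifs <;> ring
        rw [Finset.sum_congr rfl fun i _ => h' i, Finset.sum_add_distrib, Finset.sum_ite_eq' Finset.univ ℓ (fun i => (b : ℝ) * p i)]
        simp [hB]
      rw [e, zero_mul, zero_add]
      have h1 : (b : ℝ) * κ ≤ b * x := mul_le_mul_of_nonneg_left hκx hb0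
      have h2 : (b : ℝ) * x ≤ b * p ℓ := mul_le_mul_of_nonneg_left (hp ℓ) hb0
      have : (2 * j : ℝ) < B + b * κ := hcredit
      linarith
    have hfar := far_indepBlob p (fun i => (c' i : ℝ)) x 0 hx0.le hx1.le hp hp1 (fun i => Nat.cast_nonneg _) le_rfl (j : ℝ) hbudget
    simp only [add_zero] at hfar
    have hPle : ∑ W ∈ (Finset.univ : Finset (Finset ι)).filter (fun W => ∑ i ∈ W, (c' i : ℝ) ≤ j),
        (∏ k, if k ∈ W then p k else 1 - p k) ≤ 1 - x := by nlinarith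
    have htot := Finset.sum_filter_add_sum_filter_not (Finset.univ : Finset (Finset ι)) (fun W => ∑ i ∈ W, (c' i : ℝ) ≤ j)
      (fun W => ∏ k, if k ∈ W then p k else 1 - p k)
    rw [sum_bernoulliWeight] at htot
    have htail : ∑ W : Finset ι, (∏ k, if k ∈ W then p k else 1 - p k) *
        (if j + 1 ≤ ∑ k ∈ W, c k + (if ℓ ∈ W then b else 0) then (1 : ℝ) else 0) =
        ∑ W ∈ (Finset.univ : Finset (Finset ι)).filter (fun W => ¬ (∑ i ∈ W, (c' i : ℝ) ≤ j)),
          (∏ k, if k ∈ W then p k else 1 - p k) := by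
      rw [Finset.sum_filter]
      refine Finset.sum_congr rfl fun W _ => ?_
      rw [hsum' W]
      have hiff : j + 1 ≤ ∑ k ∈ W, c' k ↔ ¬ (∑ i ∈ W, (c' i : ℝ) ≤ j) := by
        rw [← Nat.cast_sum, Nat.cast_le, not_le, Nat.lt_iff_add_one_le]
      by_cases h : j + 1 ≤ ∑ k ∈ W, c' k
      · rw [if_pos h, if_pos (hiff.mp h), mul_one]
      · rw [if_neg h, if_neg (fun h' => h (hiff.mpr h')), mul_zero]
    rw [htail]
    linarith
  · -- (F) Markov on the heavy failures
    push Not at hG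
    -- the two conditional light-events as filter sums
    set P1 : ℝ := ∑ W ∈ (Finset.univ : Finset (Finset ι)).filter (fun W => ((∑ k ∈ W, c k : ℕ) : ℝ) ≤ (j : ℝ) - b),
      (∏ k, if k ∈ W then p k else 1 - p k) with hP1
    set P0 : ℝ := ∑ W ∈ (Finset.univ : Finset (Finset ι)).filter (fun W => ((∑ k ∈ W, c k : ℕ) : ℝ) ≤ (j : ℝ)),
      (∏ k, if k ∈ W then p k else 1 - p k) with hP0
    have hP1nn : 0 ≤ P1 := Finset.sum_nonneg fun W _ => hw0 W
    have hP0nn : 0 ≤ P0 := Finset.sum_nonneg fun W _ => hw0 W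
    -- Markov on failures at the two levels
    have hM1 : (C - ((j : ℝ) - b)) * P1 ≤ C - B := heavy_fail_markov p hp0 hp1 c ((j : ℝ) - b)
    have hM0 : (C - (j : ℝ)) * P0 ≤ C - B := heavy_fail_markov p hp0 hp1 c (j : ℝ)
    -- `φ = C − B ≤ (1 − x)(C − j)`
    have hφ : C - B ≤ (1 - x) * (C - j) := by
      by_cases hk : κ ≤ 1 - x
      · have h1 : (j : ℝ) * κ ≤ j * (1 - x) := mul_le_mul_of_nonneg_left hk hj0
        have h2 : x * C ≤ x * (2 * j) := mul_le_mul_of_nonneg_left hcorner hx0.le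
        linarith only [hBlow, h1, h2]
      · push Not at hk
        have hgpos : 0 < g := lt_of_lt_of_le (by positivity) hgl
        -- `g > x² + (1−x)² ≥ 1 − x`
        have hg1' : 1 - x ≤ g := by
          have hk' : (1 - x) * (1 - x) < g - x ^ 2 := by rw [hκ, lt_div_iff₀ h1x] at hk; linarith only [hk]
          nlinarith only [hk', hxhalf]
        have hq : x ≤ g * (1 + x - κ) := by
          have e : (g * (1 + x - κ) - x) * (1 - x) = (x - g) * (g + x - 1) := by
            rw [hκ]; field_simp; ring
          have hnn : 0 ≤ (x - g) * (g + x - 1) := mul_nonneg (by linarith only [hgu]) (by linarith only [hg1'])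
          have : 0 ≤ (g * (1 + x - κ) - x) * (1 - x) := by rw [e]; exact hnn
          have := (mul_nonneg_iff_of_pos_right h1x).mp this
          linarith only [this]
        have h1 : x * (g * C) < x * j := mul_lt_mul_of_pos_left hG hx0
        have h2 : (j : ℝ) * x ≤ j * (g * (1 + x - κ)) := mul_le_mul_of_nonneg_left hq hj0
        have h12 : x * C * g < (j * (1 + x - κ)) * g := by linarith only [h1, h2]
        have h3 : x * C < j * (1 + x - κ) := lt_of_mul_lt_mul_right h12 hgpos.le
        linarith only [hBlow, h3]
    -- `P(N ≤ j) = g·P1 + (1 − g)·P0 ≤ φ/(C − j) ≤ 1 − x`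
    have hCj : 0 < C - j := by linarith only [hjC]
    have hP0le : P0 ≤ 1 - x := by
      have h : (C - j) * P0 ≤ (C - j) * (1 - x) := by linarith only [hM0, hφ]
      exact le_of_mul_le_mul_left h hCj
    have hP1le : P1 ≤ 1 - x := by
      have h2 : (C - j) * P1 ≤ (C - ((j : ℝ) - b)) * P1 := mul_le_mul_of_nonneg_right (by linarith only [hb0]) hP1nn
      have h : (C - j) * P1 ≤ (C - j) * (1 - x) := by linarith only [hM1, hφ, h2]
      exact le_of_mul_le_mul_left h hCj
    -- complement form of the claim
    have hsplit1 : ∑ W : Finset ι, (∏ k, if k ∈ W then p k else 1 - p k) * (if j + 1 ≤ ∑ k ∈ W, c k + b then (1 : ℝ) else 0) = 1 - P1 := by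
      have htot := Finset.sum_filter_add_sum_filter_not (Finset.univ : Finset (Finset ι))
        (fun W => ((∑ k ∈ W, c k : ℕ) : ℝ) ≤ (j : ℝ) - b) (fun W => ∏ k, if k ∈ W then p k else 1 - p k)
      rw [sum_bernoulliWeight] at htot
      have e : ∑ W : Finset ι, (∏ k, if k ∈ W then p k else 1 - p k) * (if j + 1 ≤ ∑ k ∈ W, c k + b then (1 : ℝ) else 0) =
          ∑ W ∈ (Finset.univ : Finset (Finset ι)).filter (fun W => ¬ (((∑ k ∈ W, c k : ℕ) : ℝ) ≤ (j : ℝ) - b)),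
            (∏ k, if k ∈ W then p k else 1 - p k) := by
        rw [Finset.sum_filter]
        refine Finset.sum_congr rfl fun W _ => ?_
        have hiff : j + 1 ≤ ∑ k ∈ W, c k + b ↔ ¬ (((∑ k ∈ W, c k : ℕ) : ℝ) ≤ (j : ℝ) - b) := by
          rw [not_le, sub_lt_iff_lt_add, ← Nat.cast_add, Nat.cast_lt, Nat.lt_iff_add_one_le]
        by_cases h : j + 1 ≤ ∑ k ∈ W, c k + b
        · rw [if_pos h, if_pos (hiff.mp h), mul_one]
        · rw [if_neg h, if_neg (fun h' => h (hiff.mpr h')), mul_zero]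
      rw [e]; linarith
    have hsplit0 : ∑ W : Finset ι, (∏ k, if k ∈ W then p k else 1 - p k) * (if j + 1 ≤ ∑ k ∈ W, c k then (1 : ℝ) else 0) = 1 - P0 := by
      have htot := Finset.sum_filter_add_sum_filter_not (Finset.univ : Finset (Finset ι))
        (fun W => ((∑ k ∈ W, c k : ℕ) : ℝ) ≤ (j : ℝ)) (fun W => ∏ k, if k ∈ W then p k else 1 - p k)
      rw [sum_bernoulliWeight] at htot
      have e : ∑ W : Finset ι, (∏ k, if k ∈ W then p k else 1 - p k) * (if j + 1 ≤ ∑ k ∈ W, c k then (1 : ℝ) else 0) =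
          ∑ W ∈ (Finset.univ : Finset (Finset ι)).filter (fun W => ¬ (((∑ k ∈ W, c k : ℕ) : ℝ) ≤ (j : ℝ))),
            (∏ k, if k ∈ W then p k else 1 - p k) := by
        rw [Finset.sum_filter]
        refine Finset.sum_congr rfl fun W _ => ?_
        have hiff : j + 1 ≤ ∑ k ∈ W, c k ↔ ¬ (((∑ k ∈ W, c k : ℕ) : ℝ) ≤ (j : ℝ)) := by
          rw [not_le, Nat.cast_lt, Nat.lt_iff_add_one_le]
        by_cases h : j + 1 ≤ ∑ k ∈ W, c k
        · rw [if_pos h, if_pos (hiff.mp h), mul_one]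
        · rw [if_neg h, if_neg (fun h' => h (hiff.mpr h')), mul_zero]
      rw [e]; linarith
    have hexp : ∑ W : Finset ι, (∏ k, if k ∈ W then p k else 1 - p k) *
        (g * (if j + 1 ≤ ∑ k ∈ W, c k + b then (1 : ℝ) else 0) + (1 - g) * (if j + 1 ≤ ∑ k ∈ W, c k then (1 : ℝ) else 0)) =
        g * (1 - P1) + (1 - g) * (1 - P0) := by
      rw [← hsplit1, ← hsplit0, Finset.mul_sum, Finset.mul_sum, ← Finset.sum_add_distrib]
      exact Finset.sum_congr rfl fun W _ => by ring
    rw [hexp]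
    have e1 : g * x ≤ g * (1 - P1) := mul_le_mul_of_nonneg_left (by linarith only [hP1le]) hg0
    have e2 : (1 - g) * x ≤ (1 - g) * (1 - P0) := mul_le_mul_of_nonneg_left (by linarith only [hP0le]) (by linarith only [hg1])
    linarith only [e1, e2]

end IndepBlob

end Quant

end Summit.CriticalPhenomena.PercolationContinuityZ3.Theorems
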